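import Literature.NumberTheory.EllipticCurves.ModularCurve
import Literature.NumberTheory.EllipticCurves.QuadraticTwist
import Literature.NumberTheory.EllipticCurves.GlobalMinimalModel
import Literature.NumberTheory.EllipticCurves.KellerYin2024.PotentiallyGoodOrdinaryPConverse
import Literature.NumberTheory.DiophantineGeometry.Conductor
import HarnessLib
import HarnessLib.Audit.Tags

/-!
# Candidates E-imc-9a / E-imc-9: the ORDINARY DETWIST laws — optimality commutes with the ramified twist in
# potentially-ordinary cells (`OrdinaryTwistCommutes p`) and multiplies the optimal degree by exactly `p`
# from the unstarred end (`OrdinaryRamifiedTwistLaw p`)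
# — cell `bsd-f2-manin` (D-0131 (3) frontier: the Manin constant at additive primes). `@[conjecture]`
# leaf (NOTHING asserted; definitions only; proved edges in `OrdinaryRamifiedTwistEdges.lean`).

HONEST FRAMING. LENS = Iwasawa-main-conjecture / Hida-family reading of the additive prime (planner-of-
record `bsd-f2-manin-imc` g2, HOME `run/shared/lean/pub/bsd-f2-manin/MEMO-imc.md` §10 «ordinary detwist»),
Props VERBATIM from HOME/imc/Sketch-imc-g2.lean v3 (sha16 67903f81d6ef5b7a, namespace `BsdF2ManinImc`,
farm rc 0) with `pStar p = (((-1)^(p/2) · p : ℤ) : ℚ)` and `IsLatticeOptimal D` (the lattice clause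
`Λ_W = c·Λ_f`, «`D` is the `X₀(N)`-optimal parametrisation up to sign») inlined as in the landed g0/g1
leaves. The dictionary (memo §10): at an additive potentially-good prime `p ≥ 5` the curve is potentially
ORDINARY iff the inertial type is principal series iff `e ∣ p − 1`; then `f_E = g ⊗ ψ` with `g` a
`p`-ordinary newform on `Γ₁`, and both members `f_E`, `f_E ⊗ χ_{p*}` of a ramified twist pair are twists
of the same ordinary `g`. «Potentially good ordinary at `p`» is the tree's
`WeierstrassCurve.HasPotentiallyGoodOrdinaryReductionAtPrime` (Keller–Yin file); the unstarred /
non-`I₀*` side conditions are read on `v_p Δ_min` of the globally minimal model (`< 6`, `≠ 6`).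

THE ROWS. E-imc-9a `OrdinaryTwistCommutes p`: `p ≥ 5`, `p² ∣ N`, `W` globally minimal and `X₀(N)`-optimal,
potentially good ORDINARY at `p` with `v_p Δ_min ≠ 6` (not `I₀*`): every globally minimal model `W′` of
`W ⊗ χ_{p*}` is again `X₀`-optimal (carries a datum with the lattice clause at its conductor level).
E-imc-9 `OrdinaryRamifiedTwistLaw p`: same binders from the UNSTARRED end (`v_p Δ_min < 6`): `W′` is
`X₀`-optimal AND every optimal datum of `W′` has degree exactly `p · deg φ_D`. BC5 WITNESS (memo §10,
HOME/imc/g2-ordss.out, g2-ordjoin.out; ecdata N < 4·10⁵ pooled, N < 10⁵ pairwise): pooled `v_p(deg φ₀)`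
histograms of T and T* agree bin-for-bin after a shift by one in every potentially-ordinary cell
(II↔IV* 26 752 classes, III↔III* 28 741, IV↔II* 12 120); pairwise 15 624 / 15 624 directed potentially-
ordinary rows commute with exact ratio `p^{±1}` (352 with a rational `p`-isogeny); all 586 FLIP rows at
`p ≥ 5` are potentially supersingular. Refuter verdicts: REF1 **E-imc-9a SURVIVES, E-imc-9 SURVIVES**
2026-08-27T16:22Z (HOME/REFUTER-ref1.md §R5: rc 0, BC7 CLEAN, HOME/ref1-C9-imc-g2.lean; independent
engine N < 5·10⁵: 9a 170 216 / 170 216 incl. 1 076 isogeny + 1 102 CM rows, 9 exact ratio `p` 85 108 /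
85 108; no hidden Irr/CM binder needed); REF2: HOME/REFUTER-ref2.md (v3 §C″; 9a's T–T*-isogeny half
reduces to Dokchitser–Dokchitser arXiv:1208.5519 Thm 7 / Cor 8; the laws as stated NOT in print).
-/

noncomputable section

open scoped MatrixGroups ModularForm

open CongruenceSubgroup WeierstrassCurve
  Literature.NumberTheory.EllipticCurves Literature.NumberTheory.EllipticCurves.ModularForms

namespace Summit.BirchSwinnertonDyer.Rank1Residual.ManinAdditive

/-- **Candidate E-imc-9a `OrdinaryTwistCommutes p` (cell bsd-f2-manin; a LAW, NOT in print as stated,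
nothing asserted):** for a prime `p ≥ 5` with `p² ∣ N`, a globally minimal `X₀(N)`-optimal `W` (datum `D`
at the conductor level with the lattice clause `Λ_W = c·Λ_f`), potentially good ORDINARY at `p` with
`v_p Δ_min(W) ≠ 6`, and any globally minimal model `W′ = C • (W ⊗ χ_{p*})` of the ramified twist:
`W′` carries an `X₀`-optimal datum at its conductor level.
[cite: DokchitserLocalInvariants2015, Thm. 7 and Cor. 8 (arXiv:1208.5519 p. 6; the T–T*-isogeny half only — the
commutation law for OPTIMAL curves is NOT in print, cell bsd-f2-manin MEMO-imc.md §10, E-imc-9a)] -/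
@[conjecture] def OrdinaryTwistCommutes (p : ℕ) : Prop :=
  ∀ (W W' : WeierstrassCurve ℚ) [W.IsElliptic] [W.IsGloballyMinimal] [W'.IsElliptic]
    [W'.IsGloballyMinimal] [NeZero (W.conductorNorm ℤ)] [NeZero (W'.conductorNorm ℤ)]
    (D : ModularParametrizationData W (W.conductorNorm ℤ)) (C : WeierstrassCurve.VariableChange ℚ),
    p.Prime → 5 ≤ p → p ^ 2 ∣ W.conductorNorm ℤ →
    W.HasPotentiallyGoodOrdinaryReductionAtPrime p →
    padicValInt p W.minimalDiscriminantInt ≠ 6 →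
    (∀ z ∈ D.L.lattice, ∃ w ∈ periodLattice D.f, z = D.c * w) →
    C • W.quadraticTwist ((((-1 : ℤ) ^ (p / 2) * p : ℤ) : ℚ)) = W' →
    ∃ D' : ModularParametrizationData W' (W'.conductorNorm ℤ),
      ∀ z ∈ D'.L.lattice, ∃ w ∈ periodLattice D'.f, z = D'.c * w

/-- **Candidate E-imc-9 `OrdinaryRamifiedTwistLaw p` (cell bsd-f2-manin; the ordinary-detwist law, NOT
in print, nothing asserted):** same binders with `W` at the UNSTARRED end (`v_p Δ_min(W) < 6`: types II,
III, IV): the twist `W′ = C • (W ⊗ χ_{p*})` is `X₀`-optimal AND every `X₀`-optimal datum `D′` of `W′`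
(lattice clause at its conductor level) has `deg φ_{D′} = p · deg φ_D`.
[cite: Watkins2002, §2.1 p. 491 (shape only: the degree identity under twists; the exact law for OPTIMAL
degrees in potentially-ordinary cells is NOT in print — cell bsd-f2-manin MEMO-imc.md §10, E-imc-9)] -/
@[conjecture] def OrdinaryRamifiedTwistLaw (p : ℕ) : Prop :=
  ∀ (W W' : WeierstrassCurve ℚ) [W.IsElliptic] [W.IsGloballyMinimal] [W'.IsElliptic]
    [W'.IsGloballyMinimal] [NeZero (W.conductorNorm ℤ)] [NeZero (W'.conductorNorm ℤ)]
    (D : ModularParametrizationData W (W.conductorNorm ℤ)) (C : WeierstrassCurve.VariableChange ℚ),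
    p.Prime → 5 ≤ p → p ^ 2 ∣ W.conductorNorm ℤ →
    W.HasPotentiallyGoodOrdinaryReductionAtPrime p →
    padicValInt p W.minimalDiscriminantInt < 6 →
    (∀ z ∈ D.L.lattice, ∃ w ∈ periodLattice D.f, z = D.c * w) →
    C • W.quadraticTwist ((((-1 : ℤ) ^ (p / 2) * p : ℤ) : ℚ)) = W' →
    (∃ D₁ : ModularParametrizationData W' (W'.conductorNorm ℤ),
        ∀ z ∈ D₁.L.lattice, ∃ w ∈ periodLattice D₁.f, z = D₁.c * w) ∧
      (∀ D' : ModularParametrizationData W' (W'.conductorNorm ℤ),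
        (∀ z ∈ D'.L.lattice, ∃ w ∈ periodLattice D'.f, z = D'.c * w) →
        D'.modularDegree = p * D.modularDegree)

end Summit.BirchSwinnertonDyer.Rank1Residual.ManinAdditive

end
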